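import Summits.QuantumFields.YangMills.Theorems.UnitScaleTiltFluctuationComparisonRegPrGlobalSlackKernelLegRefV4
import Summits.QuantumFields.YangMills.Theorems.UnitScaleTiltFluctuationComparisonRegPrGlobalSlackKernelLegRefOwn
import HarnessLib

/-!
# `UnitScaleTiltFluctuationComparisonRegPrGlobalSlackKernelLegRefOwnV4` — THE v4 TWIN (★★OWNER RULING g26-№14 (F-2b); P22b display branch, width seat ym-ust-20520-w2 g4; skeleton v5kD; record-free decls imported from `…KernelLegRefOwn`) of `…KernelLegRefOwn` — THE PER-RUN REFERENCE ROWS OF 3⁗χ IN EACH RUN'S OWN INDEXING, AND THE (M6) GEOMETRY THAT CARRIES THEM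
# ACROSS THE REFINEMENT (crux `FluctuationComparisonRegPrIntL`, stmt-QuantumFields-20520, skeleton v5kC, STUB 3⁗χ `stub_globalTwoRunSlackFamChiV4`; width seat ym-ust-20520-w1 g0, count-neutral)

WHY.  `…KernelLegRef` (same seat) types 3⁗χ's two cross-run rows as per-run closeness rows `KernelRefΦ` / `CfgRefΦ` against run-independent reference objects; like every row
of record they carry TWO clauses, run `K`'s and run `K+1`'s, both INDEXED BY RUN `K`'s localisation domains `Y ∈ Loc K k triv (1+b)` (run `K+1`'s clause at `(b+1, refineSet Y)`,
with run `K`'s tree length and leg distances).  A v4 per-run record (NODE O) displays each run's closeness in THAT RUN'S OWN indexing.  This file proves that the own-indexed rows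
give the rows of `…KernelLegRef`, the passage being pure geometry of the canonical polymerisation — slack g0's located item (M6) «`dj_{K+1}(refine Y) = dj_K(Y)`»:

* §1 (M6) **`canonTreeLenRows_refineSet`**: `𝓛_{K+1}(k+2, refineSet Y) = 𝓛_K(k+1, Y)` for EVERY point set `Y` (`k ≤ m + K`) — the step-`k` domains of run `K` with point set `Y` and
  the step-`(k+1)` domains of run `K+1` with point set `refineSet Y` correspond under `domCast` (`refineSet_domSet`, `refineSet_injective`), with equal `dj` (`dj_domCast`);
  `chartIndex_le_of_mem_canonLocRows` (`Y ∈ Loc K k triv (1+b) ⟹ b ≤ K`).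
* §2 the bond transport is a contraction (`opNorm_transport_le`, from lane A's `norm_transport_le`) and the transported weighted kernel difference is the weighted difference one run up,
  precomposed with the transport (`kerT_sub_compLegL_eq`, matched distances) — so its norm is at most run `K+1`'s own weighted norm (`norm_kerT_sub_compLegL_le`).
* §3 the own-indexed rows **`KernelRefOwnΦ`** (run `K`'s kernels at `(b, Y)` near the reference, for ALL point sets `Y` — off the localisation domains the charts are free, take
  them equal to the reference) and **`CfgRefOwnΦ`** (run `K`'s loop variables on its own window/domains near the reference), and the transfers **`kernelRefΦ_of_own`**
  (hypotheses: matched distances, tree length non-decreasing under refinement on the domains, `0 ≤ κ, C, a`, `1 ≤ L`) and **`cfgRefΦ_of_own`** (hypotheses: `LocMatched`, matched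
  nonnegative distances, window positivity letters) — triangle-free bookkeeping: the run-`(K+1)` clause of the form-(f) row IS run `K+1`'s own clause at `(K+1, b+1, refineSet Y)`.
* §4 the geometry DISCHARGED at the χ-record's canonical polymerisation: **`kernelRefΦ_canonRows_of_own`**, **`cfgRefΦ_canonRows_of_own`** (`canonTreeLenRows_refineSet`,
  `locMatched_canonRows`, `canonLegDist_matched`, `canonLegDist_nonneg`).
HONEST FRAMING: geometry + bookkeeping over hypothesis schemas; nothing of [Balaban1985UV3] / [King1986] is asserted; registry untouched; YM₃ on T³ is a rung, not the Clay problem.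

References: C. King, CMP 102 (1986) 649–677 [King1986] (Prop. 3.6 (3.56) p.662, (3.58)–(3.61) p.663, Prop. 3.9 (3.71)–(3.72) p.665); T. Bałaban, CMP 102 (1985) 255–275
[Balaban1985UV3] ((24)–(25) p.262, (43)–(45) pp.266–267, (59) p.270); CMP 109 (1987) 249–301 [Balaban1987RG1] ((0.1) p.251).
-/

set_option autoImplicit false

noncomputable section

open scoped BigOperators
open Finset
open Literature.MathematicalPhysics.QuantumFieldTheory.Balaban1983to89
open Literature.MathematicalPhysics.QuantumFieldTheory.Balaban1983to89.T3ContinuumYM3Torus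
open Literature.MathematicalPhysics.QuantumFieldTheory.Balaban1983to89.T3UnitScaleTilt
open Literature.MathematicalPhysics.QuantumFieldTheory.Balaban1983to89.T3LevelShift
open Literature.MathematicalPhysics.QuantumFieldTheory.Balaban1983to89.T3AlphaInputsAC
open Literature.MathematicalPhysics.QuantumFieldTheory.Balaban1983to89.T3AlphaPolymerSocket
open Literature.MathematicalPhysics.QuantumFieldTheory.Balaban1983to89.T3AlphaInputsACTwoRun
open Literature.MathematicalPhysics.QuantumFieldTheory.Balaban1983to89.T3AlphaInputsACTwoRunLevel
open Literature.MathematicalPhysics.QuantumFieldTheory.Balaban1983to89.TreeLengthTorus (tsys)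
open Literature.MathematicalPhysics.QuantumFieldTheory.Balaban1985CMP102
open Literature.MathematicalPhysics.QuantumFieldTheory.Balaban1985CMP102.Setting
open Summit.QuantumFields.Balaban3D.Carriers
open Summit.QuantumFields.Balaban3D.Proofs.Primitives
open Summit.QuantumFields.Balaban3D.Proofs.GroupModelLieC (lieC)
open Summit.QuantumFields.Balaban3D.Proofs.Representation33 (jet26)
open Summit.QuantumFields.YangMills.Theorems
open Summit.QuantumFields.YangMills.Theorems.GlobalSlackKernelMatching
open Summit.QuantumFields.YangMills.Theorems.GlobalSlackCanonicalPolymers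

namespace Summit.QuantumFields.YangMills.Theorems.GlobalSlackKernelLeg

/-! ## §1 (M6) The canonical tree length and the chart index across the refinement -/

section Geometry

variable {F : T3Family} {𝔠 : AlphaConsts F.L (suGroupModel 2).N} {γ : ℝ} {hγ : 0 < γ} {hγ1 : γ ≤ (min 𝔠.gamma0 1) ^ 2}

/-- **(M6) THE CANONICAL TREE LENGTH IS MATCHED ACROSS THE REFINEMENT**: for every point set `Y` of run `K`'s fine torus and every step `k ≤ m + K`,
`canonTreeLenRows q (K+1) (k+2) (refineSet Y) = canonTreeLenRows q K (k+1) Y` — the step-`k` domains of run `K` with point set `Y` and the step-`(k+1)` domains of run `K+1`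
with point set `refineSet Y` correspond under `domCast` (same number of big blocks per direction), with the same tree length. [cite: Balaban1985UV3, (24)-(25) p.262, (59) p.270; Balaban1987RG1, (0.1) p.251] -/
theorem canonTreeLenRows_refineSet (q : ∀ K, AlphaInputsT3AC.PkgCoreRows F 𝔠 γ hγ hγ1 K) (K k : ℕ) (hkm : k ≤ F.m + K) (Y : Set (Site (F.P K) 0)) :
    canonTreeLenRows q (K + 1) (k + 1 + 1) (refineSet F K Y) = canonTreeLenRows q K (k + 1) Y := by
  have hN := nblkOf_succ_eq (F := F) (𝔠 := 𝔠) (γ := γ) (hγ := hγ) (hγ1 := hγ1) K k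
  unfold canonTreeLenRows
  show sInf ((fun X' => (tsys 3 (nblkOf (SK F 𝔠 γ hγ hγ1 (K + 1)) 𝔠.lane.carrier (k + 1))).dj X') ''
      {X' : (tsys 3 (nblkOf (SK F 𝔠 γ hγ hγ1 (K + 1)) 𝔠.lane.carrier (k + 1))).Dom |
        domSet (F := F) 𝔠.lane.carrier.M₁ (K + 1) (k + 1) X' = refineSet F K Y}) =
    sInf ((fun X => (tsys 3 (nblkOf (SK F 𝔠 γ hγ hγ1 K) 𝔠.lane.carrier k)).dj X) ''
      {X : (tsys 3 (nblkOf (SK F 𝔠 γ hγ hγ1 K) 𝔠.lane.carrier k)).Dom | domSet (F := F) 𝔠.lane.carrier.M₁ K k X = Y})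
  congr 1
  ext t
  constructor
  · rintro ⟨X', hX', rfl⟩
    refine ⟨domCast hN.symm X', ?_, dj_domCast hN.symm X'⟩
    show domSet (F := F) 𝔠.lane.carrier.M₁ K k (domCast hN.symm X') = Y
    apply refineSet_injective K
    rw [refineSet_domSet hN _ K k hkm, domCast_domCast]
    exact hX'
  · rintro ⟨X, hX, rfl⟩
    refine ⟨domCast hN X, ?_, dj_domCast hN X⟩
    show domSet (F := F) 𝔠.lane.carrier.M₁ (K + 1) (k + 1) (domCast hN X) = refineSet F K Y
    rw [← refineSet_domSet hN _ K k hkm]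
    exact congrArg (refineSet F K) hX

/-- **A LISTED DOMAIN'S CHART INDEX IS BELOW THE RUN'S TOP**: `Y ∈ canonLocRows q K k h (1+b) ⟹ b ≤ K` (below the top the term levels are `≤ k ≤ K`; above it only the dummy level
`1`). [cite: Balaban1985UV3, (43) p.266] -/
theorem chartIndex_le_of_mem_canonLocRows (q : ∀ K, AlphaInputsT3AC.PkgCoreRows F 𝔠 γ hγ hγ1 K) {K k b : ℕ} {h : Hist (F.P K) k} {Y : Set (Site (F.P K) 0)}
    (hY : Y ∈ canonLocRows q K k h (1 + b)) : b ≤ K := by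
  classical
  cases k with
  | zero => simp [canonLocRows] at hY
  | succ j =>
    by_cases hj : j + 1 ≤ K
    · by_cases hi : 1 + b = j + 1
      · omega
      · by_cases hi' : 1 + b ∈ Finset.Icc 1 j
        · have := (Finset.mem_Icc.mp hi').2; omega
        · simp only [canonLocRows, if_pos hj, if_neg hi, if_neg hi'] at hY
          simp at hY
    · by_cases hi1 : 1 + b = 1
      · omega
      · simp only [canonLocRows, if_neg hj, if_neg hi1] at hY
        simp at hY

/-- **(M6) AT THE χ-RECORD'S DATUM**: on the listed domains the tree length does not decrease (indeed is unchanged) under the refinement —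
`𝓛_K(1+b, Y) ≤ 𝓛_{K+1}(1+(b+1), refineSet Y)` for `Y ∈ Loc K k triv (1+b)`. [cite: Balaban1985UV3, (24)-(25) p.262, (59) p.270] -/
theorem treeLen_le_refineSet_canonRows (q : ∀ K, AlphaInputsT3AC.PkgCoreRows F 𝔠 γ hγ hγ1 K) (K k b : ℕ) (Y : Set (Site (F.P K) 0))
    (hY : Y ∈ (AlphaInputsT3AC.dataOfCoreRows q (canonPolymerRows q)).Loc K k ((AlphaInputsT3AC.dataOfCoreRows q (canonPolymerRows q)).triv K k) (1 + b)) :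
    (AlphaInputsT3AC.dataOfCoreRows q (canonPolymerRows q)).treeLen K (1 + b) Y ≤
      (AlphaInputsT3AC.dataOfCoreRows q (canonPolymerRows q)).treeLen (K + 1) (1 + (b + 1)) (refineSet F K Y) := by
  have hb : b ≤ K := chartIndex_le_of_mem_canonLocRows q hY
  change canonTreeLenRows q K (1 + b) Y ≤ canonTreeLenRows q (K + 1) (1 + (b + 1)) (refineSet F K Y)
  rw [show 1 + b = b + 1 by ring, show 1 + (b + 1) = b + 1 + 1 by ring, canonTreeLenRows_refineSet q K b (by omega) Y]

end Geometry

/-! ## §2 The bond transport is a contraction; transported weighted kernel differences -/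

section Transport

variable {𝕍 : Type} [NormedAddCommGroup 𝕍] [NormedSpace ℂ 𝕍] {F : T3Family}

-- (record-free `opNorm_transport_le`: imported from the v3 module, not restated)

-- (record-free `kerT_sub_compLegL_eq`: imported from the v3 module, not restated)

-- (record-free `norm_kerT_sub_compLegL_le`: imported from the v3 module, not restated)

end Transport

/-! ## §3 The own-indexed per-run rows and the transfers -/

section Own

variable {𝕍 : Type} [NormedAddCommGroup 𝕍] [NormedSpace ℂ 𝕍] {F : T3Family} {γ : ℝ}

-- (record-free `KernelRefOwnΦ`: imported from the v3 module, not restated)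

-- (record-free `TreeLenRefinedOn`: imported from the v3 module, not restated)

-- (record-free `kernelRefΦ_of_own`: imported from the v3 module, not restated)

-- (record-free `CfgRefOwnΦ`: imported from the v3 module, not restated)

-- (record-free `cfgRefΦ_of_own`: imported from the v3 module, not restated)

end Own

/-! ## §4 The geometry discharged at the χ-record's canonical polymerisation -/

section Canon

variable {F : T3Family} {𝔠 : AlphaConsts F.L (suGroupModel 2).N} {γ : ℝ} {hγ : 0 < γ} {hγ1 : γ ≤ (min 𝔠.gamma0 1) ^ 2}

/-- `TreeLenRefinedOn` HOLDS for the canonical polymerisation of every family of data cores (`treeLen_le_refineSet_canonRows`). [cite: Balaban1985UV3, (24)-(25) p.262] -/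
theorem treeLenRefinedOn_canonRows (q : ∀ K, AlphaInputsT3AC.PkgCoreRows F 𝔠 γ hγ hγ1 K) : TreeLenRefinedOn (AlphaInputsT3AC.dataOfCoreRows q (canonPolymerRows q)) :=
  fun K k b Y hY => treeLen_le_refineSet_canonRows q K k b Y hY

/-- **THE OWN-INDEXED KERNEL ROW GIVES `KernelRefΦ` AT THE χ-RECORD'S CANONICAL POLYMERISATION** (canonical leg distance; decay `κ ≥ 0`, e.g. `𝔠.κ`; `0 ≤ C`, `0 ≤ a`) — no
hypothesis left but the row. [cite: King1986, Prop. 3.6 (3.56) p.662; Balaban1985UV3, (24)-(25) p.262] -/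
theorem kernelRefΦ_canonRows_of_own (p : ∀ K, AlphaInputsT3AC.PkgAtV4Chi F 𝔠 γ hγ hγ1 K) {Φ Ψ : ChartFam ↥(lieC (suGroupModel 2)) F} {κ' κ a C : ℝ}
    (hκ : 0 ≤ κ) (hC : 0 ≤ C) (ha : 0 ≤ a)
    (h : KernelRefOwnΦ (AlphaInputsT3AC.dataOfV4chi p (canonPolymerRows fun K => (p K).toRows)) Φ Ψ (canonLegDist F) κ' κ a C) :
    KernelRefΦ (AlphaInputsT3AC.dataOfV4chi p (canonPolymerRows fun K => (p K).toRows)) Φ Ψ (canonLegDist F) κ' κ a C :=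
  kernelRefΦ_of_own (canonLegDist_matched F) (treeLenRefinedOn_canonRows fun K => (p K).toRows) hκ hC ha F.hL.2.le h

/-- **THE OWN-INDEXED LOOP-VARIABLE ROW GIVES `CfgRefΦ` AT THE χ-RECORD'S CANONICAL POLYMERISATION** (canonical leg distance; `LocMatched` = `locMatched_canonRows`; window letters
from the record: `𝔠.b₀ > 0`, `γ ≤ (min γ₀ 1)² ≤ 1`). [cite: King1986, Prop. 3.9 (3.71)-(3.72) p.665; Balaban1987RG1, (0.1) p.251] -/
theorem cfgRefΦ_canonRows_of_own (p : ∀ K, AlphaInputsT3AC.PkgAtV4Chi F 𝔠 γ hγ hγ1 K) {B BR : CfgFam ↥(lieC (suGroupModel 2)) F} {a C_B : ℝ}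
    (hCB : 0 ≤ C_B) (ha : 0 ≤ a)
    (h : CfgRefOwnΦ (AlphaInputsT3AC.dataOfV4chi p (canonPolymerRows fun K => (p K).toRows)) B BR (canonLegDist F) 𝔠.b₀ 𝔠.p₀ a C_B) :
    CfgRefΦ (AlphaInputsT3AC.dataOfV4chi p (canonPolymerRows fun K => (p K).toRows)) B BR (canonLegDist F) 𝔠.b₀ 𝔠.p₀ a C_B :=
  cfgRefΦ_of_own (locMatched_canonRows fun K => (p K).toRows) (canonLegDist_matched F) (canonLegDist_nonneg F) F.hL.2.le hγ
    (hγ1.trans (sq_min_one_le _ 𝔠.gamma0_pos)) 𝔠.b₀_pos hCB ha h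

end Canon

end Summit.QuantumFields.YangMills.Theorems.GlobalSlackKernelLeg

end
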